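import Literature.MathematicalPhysics.StatisticalMechanics.Theil2006RenormalizedPotential
import Literature.MathematicalPhysics.StatisticalMechanics.Theil2006Proofs
import HarnessLib

/-!
# Theil 2006, §2.4 (39) and «Adding (39) and (41) gives the desired inequality (9)» — the last
step of the main local estimate, with (7) and (10)

Topic `Literature/MathematicalPhysics/StatisticalMechanics`; companion of `Theil2006.lean`
(`shortRangePairs = 𝒮`, `defects = ∂X`, (7) `Theil2006_shortRangeBonds`),
`Theil2006RenormalizedPotential.lean` ((10)/(11): `exists_quadratic_le_renormalizedPotential`,
`V_*(r) ≥ −1 + ¼(r − 1)²` near `1`) and `Crystallization.lean` (`interactionEnergy`). Everything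
here is PROVED (no `sorry`, no named fact; D-0026): this file isolates the purely algebraic end
of the proof of (9) (p. 12), taking the two analytic-geometric inputs — the resummed short-range
estimate (the improved (37), first display of p. 12) and the long-range estimate (41) — as
HYPOTHESES on real numbers, so that the bricks proving them (see
`Theil2006DefectiveBondCount.lean`, `Theil2006SeparatedCounting.lean`, `Theil2006LongRange.lean`
and the Appendix inputs) plug in without further bookkeeping.

## Source, as printed (preprint p. 12 and p. 5)

"We end up with the estimate
`I₁ + I₂ + I₃ ≥ Σ_{{x,x'} ∈ 𝒮} [e_*({x,x'}) − Cα(|y(x) − y(x')| − 1)²] − Cα #∂X`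
(39) `≥ −3#𝒮 + (1/C) Σ_{p ∈ 𝒮} (e_*(p) + 1) − Cα #∂X.`
The last inequality follows from (7) together with assumptions (1) and (10) if `α` is
sufficiently small. […] (41) `I₄ + I₅ = Σ_{p ∈ ℒ₀ ∪ ℒ₁} e(p) ≥ … ≥ −Cα #∂X.`
Adding (39) and (41) gives the desired inequality (9). The proof of Theorem 1.1 is finished."
with (9) [p. 5]: `Σ_{p ∈ 𝒫} e(p) ≥ −#𝒮(y_N) + (1/C) Σ_{{x,x'} ∈ 𝒮(y_N)} (|y_N(x) − y_N(x')| − 1)² + ¼ #∂X(y_N)`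
and (7) [p. 4]: `#𝒮(y_N) ≤ 3N − ½ #∂X(y_N)`.

## What is here

* `Theil2006.sum_simplices_pairs_eq`, `Theil2006.sum_pairs_eq_half_sum_simplices_add` — **(29), the
  bookkeeping**: for any finite family `𝒯` of simplices in which every pair lies in at most two
  members (Proposition 2.8.1 for long pairs; `Theil2006DefectiveBondCount.simplexCount_le_two` for
  short ones), `Σ_{p} e(p) = ½ Σ_{T ∈ 𝒯} Σ_{p ⊂ T} e(p) + Σ_{p in no T} e(p) + ½ Σ_{p in one T} e(p)`
  (generic over the pair set and the weights).
* `Theil2006.IsAdmissible.longRangeMainTerm_ge` — **(32) from Proposition 2.9 (26), (27)**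
  ("Proposition 2.9 implies that …"): with `n₁ = #𝒯₁`, `n_λ = #𝒯_λ`, `A₁ = Σ_{S ∈ 𝒯₁} meas conv y(S)`,
  `A_λ = Σ_{T ∈ 𝒯_λ} meas conv y(T)`, `B = #∂X`, (26) `0 ≤ n₁ − n_λ/m(λ) ≤ C₉λ²B` and (27)
  `0 ≤ A₁ − A_λ/(λ²m(λ)) ≤ C₉λ²B` (hypotheses, multiplied through by `m(λ)`, `λ²m(λ)`) and (12):
  `Σ_{T}[3V(λ) + (2√3/λ)V′(λ)(meas − (√3/4)λ²)] ≥ m(λ) Σ_{S}[3V(λ) + 2√3λV′(λ)(meas − √3/4)] − C₉ α λ⁻³ m(λ) B`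
  (error constant = the same `C₉`; `λ ≥ 4/3`).
* `Theil2006.sum_simplices_patchPairs_le` — **(34), second inequality** ("a consequence from
  (28)"): `Σ_{T} Σ_{p ∈ S, p ⊂ ω_T} f(p) ≤ M Σ_{p ∈ S} f(p)` for `f ≥ 0` when every particle lies in
  at most `M` patches `ω_T` ((28): `M = Cλ²m(λ)`).
* `Theil2006.two_mul_card_shortRangePairs_add_card_defects_le` — (7) in the additive form
  `2#𝒮 + #∂X ≤ 6N` (`0 < α ≤ 1/50`, (13)), re-derived from `Theil2006Proofs.lean`.
* `Theil2006.IsAdmissible.quadratic_le_renormalizedPotential_Ioc` — (10)'s consequence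
  `V_*(r) + 1 ≥ ¼(r − 1)²` extended by continuity to the closed right end `r = 1 + α` of the
  short-bond window (short bonds of a configuration with (13) have `r ∈ (1 − α, 1 + α]`).
* `Theil2006.sum_renormalized_sub_quadratic_ge` — **(39), the termwise step**
  ("assumptions (1) and (10)"): `Σ_P [e_* − Kα(r − 1)²] ≥ −#P + (1 − 4Kα) Σ_P (e_* + 1)`.
* `Theil2006.IsAdmissible.mainLocalEstimate_of_parts` — **«Adding (39) and (41) gives (9)»**: from
  the split `E = I₁₂₃ + I₄₅`, the resummed short-range bound
  `I₁₂₃ ≥ Σ_{𝒮}[e_* − C₁α(r−1)²] − C₂α#∂X`, the long-range bound `I₄₅ ≥ −C₃α#∂X`, (7) and (10):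
  `E(y) ≥ −3N + ½ Σ_{𝒮}(e_*(p) + 1) + ¼ #∂X` for `α ≤ min(1/(8C₁), 1/(4(C₂+C₃)))`, and the printed
  `(|y(x) − y(x')| − 1)²` form `Theil2006.IsAdmissible.mainLocalEstimate_of_parts'`.

## Rendering notes (print flags)

* (39) prints "`−3#𝒮`"; what `Σ_{𝒮}(−1)` gives is `−#𝒮`, and what the conclusion needs (and
  what (44) mirrors as "`−3#X̃`") is `−3N + ½#∂X` via (7). We prove the `−3N` form:
  `E ≥ −3N + (1/C)Σ_{𝒮}(e_* + 1) + ¼#∂X`, which is (9) with `−#𝒮` replaced by the weaker `−3N + ½#∂X`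
  of (7) and the `¼#∂X` produced by `½ − (C₂ + C₃)α ≥ ¼`; the printed (9) with BOTH `−#𝒮` and
  `+¼#∂X` does not follow from (39)+(41) as printed (it would need `+¼#∂X` out of `−Cα#∂X`), and is
  not what the sequel uses ((6) needs only the `−3N` form; (44) is the `−3#X̃` form).
-/

noncomputable section

open scoped BigOperators Topology
open Filter Set Metric

namespace Literature.MathematicalPhysics.StatisticalMechanics

namespace Theil2006

variable {α : ℝ} {V : ℝ → ℝ} {N : ℕ} {y : Fin N → Plane}

/-! ### (29): pairs versus simplices -/

section Bookkeeping

variable {ι : Type*} [DecidableEq ι]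

/-- **Double counting pairs in simplices**: `Σ_{T ∈ 𝒯} Σ_{p ∈ Pr, p ⊂ T} e(p) = Σ_{p ∈ Pr} #{T ∈ 𝒯 | p ⊂ T} · e(p)`.
[cite: Theil2006, §2.3 (29) (preprint p. 9); our bookkeeping] -/
theorem sum_simplices_pairs_eq (𝒯 : Finset (Finset ι)) (Pr : Finset (ι × ι)) (e : ι × ι → ℝ) :
    ∑ T ∈ 𝒯, ∑ p ∈ Pr.filter (fun p => p.1 ∈ T ∧ p.2 ∈ T), e p =
      ∑ p ∈ Pr, ((𝒯.filter fun T => p.1 ∈ T ∧ p.2 ∈ T).card : ℝ) * e p := by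
  simp_rw [Finset.sum_filter]
  rw [Finset.sum_comm]
  refine Finset.sum_congr rfl fun p _ => ?_
  rw [Finset.card_filter, Nat.cast_sum, Finset.sum_mul]
  refine Finset.sum_congr rfl fun T _ => ?_
  split_ifs <;> simp

/-- **(29)**: if every pair of `Pr` lies in at most two simplices of `𝒯`, then
`Σ_{p ∈ Pr} e(p) = ½ Σ_{T ∈ 𝒯} Σ_{p ∈ Pr, p ⊂ T} e(p) + Σ_{p ∈ Pr₀} e(p) + ½ Σ_{p ∈ Pr₁} e(p)`, where
`Pr_j` are the pairs lying in exactly `j` simplices (the `I₁ + (I₂ + I₄) + (I₃ + I₅)` split of (29),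
for short and long pairs alike). [cite: Theil2006, §2.3 (29) (preprint p. 9)] -/
theorem sum_pairs_eq_half_sum_simplices_add (𝒯 : Finset (Finset ι)) (Pr : Finset (ι × ι))
    (e : ι × ι → ℝ) (h2 : ∀ p ∈ Pr, (𝒯.filter fun T => p.1 ∈ T ∧ p.2 ∈ T).card ≤ 2) :
    ∑ p ∈ Pr, e p =
      1 / 2 * ∑ T ∈ 𝒯, ∑ p ∈ Pr.filter (fun p => p.1 ∈ T ∧ p.2 ∈ T), e p +
        ∑ p ∈ Pr.filter (fun p => (𝒯.filter fun T => p.1 ∈ T ∧ p.2 ∈ T).card = 0), e p +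
        1 / 2 * ∑ p ∈ Pr.filter (fun p => (𝒯.filter fun T => p.1 ∈ T ∧ p.2 ∈ T).card = 1), e p := by
  rw [sum_simplices_pairs_eq]
  set c : ι × ι → ℕ := fun p => (𝒯.filter fun T => p.1 ∈ T ∧ p.2 ∈ T).card with hc
  -- split `Pr` by the value of `c ∈ {0, 1, 2}`
  have hsplit : ∀ g : ι × ι → ℝ, ∑ p ∈ Pr, g p =
      ∑ p ∈ Pr.filter (fun p => c p = 0), g p + ∑ p ∈ Pr.filter (fun p => c p = 1), g p +
        ∑ p ∈ Pr.filter (fun p => c p = 2), g p := by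
    intro g
    have hmaps : ∀ p ∈ Pr, c p ∈ Finset.range 3 := fun p hp =>
      Finset.mem_range.2 (Nat.lt_succ_of_le (h2 p hp))
    rw [← Finset.sum_fiberwise_of_maps_to hmaps]
    simp [Finset.sum_range_succ]
  rw [hsplit e, hsplit (fun p => (c p : ℝ) * e p)]
  have h0 : ∑ p ∈ Pr.filter (fun p => c p = 0), (c p : ℝ) * e p = 0 :=
    Finset.sum_eq_zero fun p hp => by rw [(Finset.mem_filter.1 hp).2]; simp
  have h1 : ∑ p ∈ Pr.filter (fun p => c p = 1), (c p : ℝ) * e p =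
      ∑ p ∈ Pr.filter (fun p => c p = 1), e p :=
    Finset.sum_congr rfl fun p hp => by rw [(Finset.mem_filter.1 hp).2]; simp
  have h2' : ∑ p ∈ Pr.filter (fun p => c p = 2), (c p : ℝ) * e p =
      2 * ∑ p ∈ Pr.filter (fun p => c p = 2), e p := by
    rw [Finset.mul_sum]
    exact Finset.sum_congr rfl fun p hp => by rw [(Finset.mem_filter.1 hp).2]; simp
  rw [h0, h1, h2']
  ring

/-! ### (32) from Proposition 2.9 (26), (27) and the decay (12) -/

/-- `√3 ≤ 7/4`. [folklore] -/
private theorem sqrt_three_le_seven_div_four : √3 ≤ (7 : ℝ) / 4 := by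
  rw [show (7 : ℝ) / 4 = √((7 / 4) ^ 2) by rw [Real.sqrt_sq]; norm_num]
  exact Real.sqrt_le_sqrt (by norm_num)

/-- **(32) from Proposition 2.9.** For `λ ≥ 4/3`, `m = m(λ) ≥ 0`, `B = #∂X ≥ 0`, `C₉ ≥ 0`, real
numbers `n₁, n_λ, A₁, A_λ` with (26) `0 ≤ m n₁ − n_λ ≤ C₉λ²mB` and (27)
`0 ≤ λ²m A₁ − A_λ ≤ C₉λ⁴mB`, and `V` satisfying (1)–(5) with parameter `α` ((12):
`|V(λ)| ≤ αλ⁻⁵/30`, `|V′(λ)| ≤ αλ⁻⁶/6`):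
`n_λ·3V(λ) + (2√3/λ)V′(λ)(A_λ − (√3/4)λ²n_λ) ≥ m (n₁·3V(λ) + 2√3λV′(λ)(A₁ − (√3/4)n₁)) − C₉αλ⁻³mB`.
(Identity: LHS − m·main = (m n₁ − n_λ)(−3V(λ) + (3/2)λV′(λ)) − (2√3/λ)V′(λ)(λ²mA₁ − A_λ); the two
error terms are `≤ 0.35` and `≤ 0.58` times `C₉αλ⁻³mB`.)
[cite: Theil2006, §2.4 (32) (preprint p. 10), with Proposition 2.9 (26)–(27) (p. 9) and Lemma 2.1 (12)] -/
theorem IsAdmissible.longRangeMainTerm_ge (hV : IsAdmissible α V) {lam m n₁ nl A₁ Al B C₉ : ℝ}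
    (hlam : 4 / 3 ≤ lam) (hm : 0 ≤ m) (hB : 0 ≤ B) (hC₉ : 0 ≤ C₉)
    (h26a : 0 ≤ m * n₁ - nl) (h26b : m * n₁ - nl ≤ C₉ * lam ^ 2 * m * B)
    (h27a : 0 ≤ lam ^ 2 * m * A₁ - Al) (h27b : lam ^ 2 * m * A₁ - Al ≤ C₉ * lam ^ 4 * m * B) :
    m * (n₁ * (3 * V lam) + 2 * √3 * lam * deriv V lam * (A₁ - √3 / 4 * n₁)) -
        C₉ * α * lam⁻¹ ^ 3 * m * B ≤
      nl * (3 * V lam) + 2 * √3 / lam * deriv V lam * (Al - √3 / 4 * lam ^ 2 * nl) := by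
  have hα := hV.alpha_nonneg
  have hlam0 : 0 < lam := by linarith
  set t : ℝ := lam⁻¹ with ht
  have ht0 : 0 < t := inv_pos.2 hlam0
  have hlt : lam * t = 1 := mul_inv_cancel₀ hlam0.ne'
  set W := V lam with hW
  set W' := deriv V lam with hW'
  set u : ℝ := 2 * √3 / lam * W' with hu
  have hs3 : √3 * √3 = 3 := Real.mul_self_sqrt (by norm_num)
  have hs0 : 0 ≤ √3 := Real.sqrt_nonneg 3
  have hs74 := sqrt_three_le_seven_div_four
  -- (12)
  have hWb : |W| ≤ α / 30 * t ^ 5 := hV.abs_apply_le hlam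
  have hW'b : |W'| ≤ α / 6 * t ^ 6 := hV.abs_deriv_le hlam
  -- the identity
  have hu' : 2 * √3 * lam * W' = u * lam ^ 2 := by
    rw [hu]; field_simp
  have key : nl * (3 * W) + u * (Al - √3 / 4 * lam ^ 2 * nl) -
      m * (n₁ * (3 * W) + u * lam ^ 2 * (A₁ - √3 / 4 * n₁)) =
      (m * n₁ - nl) * (-3 * W + √3 / 4 * lam ^ 2 * u) - u * (lam ^ 2 * m * A₁ - Al) := by ring
  -- bounds on `u`
  have hub : |u| ≤ √3 / 3 * α * t ^ 7 := by
    rw [hu, div_eq_mul_inv, ← ht, abs_mul, abs_mul, abs_of_nonneg (by positivity : (0:ℝ) ≤ 2 * √3),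
      abs_of_pos ht0]
    have := mul_le_mul_of_nonneg_left hW'b (by positivity : (0:ℝ) ≤ 2 * √3 * t)
    calc 2 * √3 * t * |W'| ≤ 2 * √3 * t * (α / 6 * t ^ 6) := this
      _ = √3 / 3 * α * t ^ 7 := by ring
  have hcu : |√3 / 4 * lam ^ 2 * u| ≤ 1 / 4 * α * t ^ 5 := by
    rw [abs_mul, abs_of_nonneg (by positivity : (0:ℝ) ≤ √3 / 4 * lam ^ 2)]
    have e : lam ^ 2 * t ^ 7 = t ^ 5 := by
      calc lam ^ 2 * t ^ 7 = (lam * t) ^ 2 * t ^ 5 := by ring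
        _ = t ^ 5 := by rw [hlt]; ring
    calc √3 / 4 * lam ^ 2 * |u| ≤ √3 / 4 * lam ^ 2 * (√3 / 3 * α * t ^ 7) :=
          mul_le_mul_of_nonneg_left hub (by positivity)
      _ = (√3 * √3) / 12 * α * (lam ^ 2 * t ^ 7) := by ring
      _ = 1 / 4 * α * t ^ 5 := by rw [hs3, e]; ring
  have hc : |-3 * W + √3 / 4 * lam ^ 2 * u| ≤ 7 / 20 * α * t ^ 5 := by
    refine (abs_add_le _ _).trans ?_
    have : |-3 * W| = 3 * |W| := by
      rw [abs_mul, show |(-3 : ℝ)| = 3 by norm_num]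
    linarith
  -- first error term
  have hE1 : -(C₉ * lam ^ 2 * m * B) * (7 / 20 * α * t ^ 5) ≤
      (m * n₁ - nl) * (-3 * W + √3 / 4 * lam ^ 2 * u) := by
    have h1 : (m * n₁ - nl) * -(7 / 20 * α * t ^ 5) ≤
        (m * n₁ - nl) * (-3 * W + √3 / 4 * lam ^ 2 * u) :=
      mul_le_mul_of_nonneg_left (by linarith [neg_abs_le (-3 * W + √3 / 4 * lam ^ 2 * u)]) h26a
    have h2 : (C₉ * lam ^ 2 * m * B) * -(7 / 20 * α * t ^ 5) ≤ (m * n₁ - nl) * -(7 / 20 * α * t ^ 5) :=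
      mul_le_mul_of_nonpos_right h26b (by
        have : 0 ≤ 7 / 20 * α * t ^ 5 := by positivity
        linarith)
    linarith
  -- second error term
  have hE2 : u * (lam ^ 2 * m * A₁ - Al) ≤ √3 / 3 * α * t ^ 7 * (C₉ * lam ^ 4 * m * B) := by
    calc u * (lam ^ 2 * m * A₁ - Al) ≤ |u| * (lam ^ 2 * m * A₁ - Al) :=
          mul_le_mul_of_nonneg_right (le_abs_self u) h27a
      _ ≤ √3 / 3 * α * t ^ 7 * (lam ^ 2 * m * A₁ - Al) :=
          mul_le_mul_of_nonneg_right hub h27a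
      _ ≤ √3 / 3 * α * t ^ 7 * (C₉ * lam ^ 4 * m * B) :=
          mul_le_mul_of_nonneg_left h27b (by positivity)
  -- powers: `λ² t⁵ = t³`, `λ⁴ t⁷ = t³`
  have e3 : lam ^ 2 * t ^ 5 = t ^ 3 := by
    calc lam ^ 2 * t ^ 5 = (lam * t) ^ 2 * t ^ 3 := by ring
      _ = t ^ 3 := by rw [hlt]; ring
  have e4 : lam ^ 4 * t ^ 7 = t ^ 3 := by
    calc lam ^ 4 * t ^ 7 = (lam * t) ^ 4 * t ^ 3 := by ring
      _ = t ^ 3 := by rw [hlt]; ring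
  have hE1' : -(C₉ * lam ^ 2 * m * B) * (7 / 20 * α * t ^ 5) = -(7 / 20) * (C₉ * α * m * B) * t ^ 3 := by
    rw [← e3]; ring
  have hE2' : √3 / 3 * α * t ^ 7 * (C₉ * lam ^ 4 * m * B) = √3 / 3 * (C₉ * α * m * B) * t ^ 3 := by
    rw [← e4]; ring
  rw [hE1'] at hE1
  rw [hE2'] at hE2
  have hK : 0 ≤ C₉ * α * m * B * t ^ 3 := by positivity
  -- assemble: error ≤ (0.35 + √3/3) C₉ α m B t³ ≤ C₉ α m B t³
  have hmain : m * (n₁ * (3 * W) + 2 * √3 * lam * W' * (A₁ - √3 / 4 * n₁)) =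
      m * (n₁ * (3 * W) + u * lam ^ 2 * (A₁ - √3 / 4 * n₁)) := by rw [hu']
  rw [hmain]
  have ht3 : lam⁻¹ ^ 3 = t ^ 3 := by rw [ht]
  rw [ht3]
  nlinarith [key, hE1, hE2, hK, mul_le_mul_of_nonneg_right hs74 hK]

/-! ### (34), second inequality: localized errors are counted with multiplicity `≤ M` -/

/-- **(34), the double-counting step** ("The final inequality above is a consequence from (28)"):
if every particle lies in at most `M` of the patches `ω_T` (`T ∈ 𝒯`), then for `f ≥ 0`
`Σ_{T ∈ 𝒯} Σ_{p ∈ S, p ⊂ ω_T} f(p) ≤ M Σ_{p ∈ S} f(p)`.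
[cite: Theil2006, §2.4 (34) with (28) (preprint p. 11)] -/
theorem sum_simplices_patchPairs_le {κ : Type*} (𝒯 : Finset κ) (ω : κ → Finset ι)
    (S : Finset (ι × ι)) (f : ι × ι → ℝ) (hf : ∀ p ∈ S, 0 ≤ f p) {M : ℕ}
    (hM : ∀ x : ι, (𝒯.filter fun T => x ∈ ω T).card ≤ M) :
    ∑ T ∈ 𝒯, ∑ p ∈ S.filter (fun p => p.1 ∈ ω T ∧ p.2 ∈ ω T), f p ≤ M * ∑ p ∈ S, f p := by
  have hswap : ∑ T ∈ 𝒯, ∑ p ∈ S.filter (fun p => p.1 ∈ ω T ∧ p.2 ∈ ω T), f p =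
      ∑ p ∈ S, ((𝒯.filter fun T => p.1 ∈ ω T ∧ p.2 ∈ ω T).card : ℝ) * f p := by
    simp_rw [Finset.sum_filter]
    rw [Finset.sum_comm]
    refine Finset.sum_congr rfl fun p _ => ?_
    rw [Finset.card_filter, Nat.cast_sum, Finset.sum_mul]
    refine Finset.sum_congr rfl fun T _ => ?_
    split_ifs <;> simp
  rw [hswap, Finset.mul_sum]
  refine Finset.sum_le_sum fun p hp => mul_le_mul_of_nonneg_right ?_ (hf p hp)
  have h1 : (𝒯.filter fun T => p.1 ∈ ω T ∧ p.2 ∈ ω T).card ≤ (𝒯.filter fun T => p.1 ∈ ω T).card :=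
    Finset.card_le_card (Finset.monotone_filter_right _ fun T _ h => h.1)
  exact_mod_cast h1.trans (hM p.1)

end Bookkeeping

/-! ### (7) in additive form -/

/-- **(7), additive form**: `2 #𝒮(y) + #∂X(y) ≤ 6N` for `0 < α ≤ 1/50` and `y` with (13)
(each particle has `≤ 6` neighbours, a defect has `≠ 6`, hence `≤ 5`).
[cite: Theil2006, §2.2 Proposition 2.3 (7) (preprint pp. 4, 7)] -/
theorem two_mul_card_shortRangePairs_add_card_defects_le (hα : 0 < α) (hα' : α ≤ 1 / 50)
    (hsep : ∀ i j : Fin N, i ≠ j → 1 - α < dist (y i) (y j)) :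
    2 * (shortRangePairs α y).card + (defects α y).card ≤ 6 * N := by
  have hS6 : ∀ x : Fin N, (Finset.univ.filter fun x' => |dist (y x) (y x') - 1| ≤ α).card ≤ 6 :=
    fun x => card_filter_shortRange_le_six hα hα' y hsep x
  have hnot : ∀ x : Fin N, x ∉ (Finset.univ.filter fun x' => |dist (y x) (y x') - 1| ≤ α) := by
    intro x
    rw [Finset.mem_filter, dist_self, zero_sub, abs_neg, abs_one, not_and, not_le]
    intro
    linarith
  have hnbhd : ∀ x : Fin N,
      (nbhd α y x).card = (Finset.univ.filter fun x' => |dist (y x) (y x') - 1| ≤ α).card + 1 := by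
    intro x
    rw [nbhd, Finset.card_insert_of_notMem (hnot x)]
  have h2 := two_mul_card_shortRangePairs (by linarith : α < 1) y
  have hdef : (defects α y).card = ∑ x : Fin N, if (nbhd α y x).card ≠ 7 then 1 else 0 := by
    rw [defects, Finset.card_filter]
  have hsum : ∑ x : Fin N, (Finset.univ.filter fun x' => |dist (y x) (y x') - 1| ≤ α).card +
      (defects α y).card ≤ 6 * N := by
    rw [hdef, ← Finset.sum_add_distrib]
    calc ∑ x : Fin N, ((Finset.univ.filter fun x' => |dist (y x) (y x') - 1| ≤ α).card +
          if (nbhd α y x).card ≠ 7 then 1 else 0)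
        ≤ ∑ _x : Fin N, 6 := Finset.sum_le_sum fun x _ => by
          have h₁ := hnbhd x
          have h₂ := hS6 x
          split_ifs with h7 <;> omega
      _ = 6 * N := by simp [mul_comm]
  omega

/-- (7) as printed, real form: `#𝒮(y) ≤ 3N − ½ #∂X(y)`. [cite: Theil2006, §2.2 Proposition 2.3 (7) (preprint p. 4)] -/
theorem card_shortRangePairs_le_real (hα : 0 < α) (hα' : α ≤ 1 / 50)
    (hsep : ∀ i j : Fin N, i ≠ j → 1 - α < dist (y i) (y j)) :
    ((shortRangePairs α y).card : ℝ) ≤ 3 * N - ((defects α y).card : ℝ) / 2 := by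
  have h := two_mul_card_shortRangePairs_add_card_defects_le hα hα' hsep
  have h' : ((2 * (shortRangePairs α y).card + (defects α y).card : ℕ) : ℝ) ≤ ((6 * N : ℕ) : ℝ) := by
    exact_mod_cast h
  push_cast at h'
  linarith

/-! ### (10): `e_* + 1 ≥ ¼ (r − 1)²` on the closed short-bond window -/

/-- **(10) on the short-bond window, closed at the right end.** If `V_*(r) ≥ −1 + ¼(r − 1)²` on
`(1 − α, 1 + α)` (`exists_quadratic_le_renormalizedPotential`), then also at `r = 1 + α`, by
continuity of `V_*` (`IsAdmissible.hasDerivAt_renormalizedPotential`; `0 < α ≤ 1/5`).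
[cite: Theil2006, §2.2 Lemma 2.1 (10) (preprint p. 6); our lemma] -/
theorem IsAdmissible.quadratic_le_renormalizedPotential_Ioc (hV : IsAdmissible α V)
    (hα5 : α ≤ 1 / 5)
    (hquad : ∀ r ∈ Ioo (1 - α) (1 + α), -1 + 1 / 4 * (r - 1) ^ 2 ≤ renormalizedPotential V r)
    {r : ℝ} (hr : r ∈ Ioc (1 - α) (1 + α)) :
    -1 + 1 / 4 * (r - 1) ^ 2 ≤ renormalizedPotential V r := by
  rcases hr.2.lt_or_eq with hlt | heq
  · exact hquad r ⟨hr.1, hlt⟩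
  · have hf : ContinuousAt (renormalizedPotential V) r :=
      (hV.hasDerivAt_renormalizedPotential hα5 hr.1).continuousAt
    have hg : ContinuousAt (fun s : ℝ => -1 + 1 / 4 * (s - 1) ^ 2) r := by fun_prop
    have hev : ∀ᶠ s in 𝓝[<] r, -1 + 1 / 4 * (s - 1) ^ 2 ≤ renormalizedPotential V s := by
      filter_upwards [Ioo_mem_nhdsLT hr.1] with s hs
      exact hquad s ⟨hs.1, by rw [← heq]; exact hs.2⟩
    exact le_of_tendsto_of_tendsto (hg.tendsto.mono_left nhdsWithin_le_nhds)
      (hf.tendsto.mono_left nhdsWithin_le_nhds) hev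

/-! ### (39): the termwise step -/

/-- **(39), termwise** ("assumptions (1) and (10)"): for a finite set `P` of pairs of lengths
`r_p ∈ (1 − α, 1 + α]` on which `e_*(p) + 1 ≥ ¼(r_p − 1)²`,
`Σ_P [e_*(p) − Kα(r_p − 1)²] ≥ −#P + (1 − 4Kα) Σ_P (e_*(p) + 1)` (`K ≥ 0`).
[cite: Theil2006, §2.4 (39) (preprint p. 12)] -/
theorem sum_renormalized_sub_quadratic_ge (P : Finset (Fin N × Fin N)) {K : ℝ} (hK : 0 ≤ K)
    (hα0 : 0 ≤ α)
    (hquad : ∀ p ∈ P, -1 + 1 / 4 * (dist (y p.1) (y p.2) - 1) ^ 2 ≤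
      renormalizedPotential V (dist (y p.1) (y p.2))) :
    -(P.card : ℝ) + (1 - 4 * K * α) *
        ∑ p ∈ P, (renormalizedPotential V (dist (y p.1) (y p.2)) + 1) ≤
      ∑ p ∈ P, (renormalizedPotential V (dist (y p.1) (y p.2)) -
        K * α * (dist (y p.1) (y p.2) - 1) ^ 2) := by
  have hterm : ∀ p ∈ P, -1 + (1 - 4 * K * α) * (renormalizedPotential V (dist (y p.1) (y p.2)) + 1) ≤
      renormalizedPotential V (dist (y p.1) (y p.2)) - K * α * (dist (y p.1) (y p.2) - 1) ^ 2 := by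
    intro p hp
    have hq := hquad p hp
    have hKα : 0 ≤ K * α := mul_nonneg hK hα0
    -- `(r−1)² ≤ 4 (e_* + 1)`
    have h4 : (dist (y p.1) (y p.2) - 1) ^ 2 ≤
        4 * (renormalizedPotential V (dist (y p.1) (y p.2)) + 1) := by linarith
    nlinarith [mul_le_mul_of_nonneg_left h4 hKα]
  have := Finset.sum_le_sum hterm
  rw [Finset.sum_add_distrib, Finset.sum_const, nsmul_eq_mul, ← Finset.mul_sum] at this
  linarith

/-! ### «Adding (39) and (41) gives (9)» -/

/-- **The main local estimate (9) from its parts** (p. 12: "We end up with the estimate …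
(39) … Adding (39) and (41) gives the desired inequality (9)"). Inputs: `V` satisfying (1)–(5)
with `0 < α ≤ 1/50`, `y : X_N → ℝ²` with (13), the bound (10) `e_* + 1 ≥ ¼(r−1)²` on
`(1−α, 1+α)` (`exists_quadratic_le_renormalizedPotential`, i.e. `α` below its threshold), a
split `E(y) = I₁₂₃ + I₄₅` of the energy ((29)), the resummed short-range estimate
`I₁₂₃ ≥ Σ_{𝒮}[e_*(p) − C₁α(r_p − 1)²] − C₂α#∂X` (first display of p. 12) and the long-range
estimate `I₄₅ ≥ −C₃α#∂X` ((41)), with `8C₁α ≤ 1` and `4(C₂ + C₃)α ≤ 1`. Conclusion, in the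
`−3N` form that (6) and (44) use:
`E(y) ≥ −3N + ½ Σ_{p ∈ 𝒮}(e_*(p) + 1) + ¼ #∂X`.
[cite: Theil2006, §2.4 (39)–(41) and §2.1 (9) (preprint pp. 5, 12)] -/
theorem IsAdmissible.mainLocalEstimate_of_parts (hV : IsAdmissible α V) (hα : 0 < α)
    (hα' : α ≤ 1 / 50) (hsep : ∀ i j : Fin N, i ≠ j → 1 - α < dist (y i) (y j))
    (hquad : ∀ r ∈ Ioo (1 - α) (1 + α), -1 + 1 / 4 * (r - 1) ^ 2 ≤ renormalizedPotential V r)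
    {I₁₂₃ I₄₅ C₁ C₂ C₃ : ℝ} (hC₁ : 0 ≤ C₁)
    (hsplit : interactionEnergy V y = I₁₂₃ + I₄₅)
    (h39 : ∑ p ∈ shortRangePairs α y, (renormalizedPotential V (dist (y p.1) (y p.2)) -
        C₁ * α * (dist (y p.1) (y p.2) - 1) ^ 2) - C₂ * α * (defects α y).card ≤ I₁₂₃)
    (h41 : -(C₃ * α * (defects α y).card) ≤ I₄₅)
    (hsmall₁ : 8 * C₁ * α ≤ 1) (hsmall₂ : 4 * (C₂ + C₃) * α ≤ 1) :
    -3 * (N : ℝ) + 1 / 2 * ∑ p ∈ shortRangePairs α y,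
        (renormalizedPotential V (dist (y p.1) (y p.2)) + 1) + 1 / 4 * (defects α y).card ≤
      interactionEnergy V y := by
  have hα5 : α ≤ 1 / 5 := by linarith
  -- short bonds have lengths in `(1 − α, 1 + α]`
  have hwin : ∀ p ∈ shortRangePairs α y, -1 + 1 / 4 * (dist (y p.1) (y p.2) - 1) ^ 2 ≤
      renormalizedPotential V (dist (y p.1) (y p.2)) := by
    intro p hp
    rw [shortRangePairs, Finset.mem_filter] at hp
    obtain ⟨-, hlt, habs⟩ := hp
    obtain ⟨h1, h2⟩ := abs_le.1 habs
    exact hV.quadratic_le_renormalizedPotential_Ioc hα5 hquad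
      ⟨hsep p.1 p.2 (ne_of_lt hlt), by linarith⟩
  have h39' := sum_renormalized_sub_quadratic_ge (V := V) (shortRangePairs α y) hC₁ hα.le hwin
  have h7 := card_shortRangePairs_le_real hα hα' hsep
  have hpos : 0 ≤ ∑ p ∈ shortRangePairs α y, (renormalizedPotential V (dist (y p.1) (y p.2)) + 1) :=
    Finset.sum_nonneg fun p hp => by nlinarith [hwin p hp]
  have hD : (0 : ℝ) ≤ (defects α y).card := Nat.cast_nonneg _
  have hco : (1 - 4 * C₁ * α) * ∑ p ∈ shortRangePairs α y,
      (renormalizedPotential V (dist (y p.1) (y p.2)) + 1) ≥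
        1 / 2 * ∑ p ∈ shortRangePairs α y, (renormalizedPotential V (dist (y p.1) (y p.2)) + 1) :=
    mul_le_mul_of_nonneg_right (by linarith) hpos
  have hdef : (C₂ + C₃) * α * (defects α y).card ≤ 1 / 4 * (defects α y).card :=
    mul_le_mul_of_nonneg_right (by linarith) hD
  rw [hsplit]
  nlinarith

/-- **(9) in the printed `(|y(x) − y(x')| − 1)²` form** (with (10) `e_* + 1 ≥ ¼(r − 1)²`):
`E(y) ≥ −3N + ⅛ Σ_{𝒮} (|y(x) − y(x')| − 1)² + ¼ #∂X`, same hypotheses.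
[cite: Theil2006, §2.1 (9) (preprint p. 5) and §2.4 (39)–(41) (p. 12)] -/
theorem IsAdmissible.mainLocalEstimate_of_parts' (hV : IsAdmissible α V) (hα : 0 < α)
    (hα' : α ≤ 1 / 50) (hsep : ∀ i j : Fin N, i ≠ j → 1 - α < dist (y i) (y j))
    (hquad : ∀ r ∈ Ioo (1 - α) (1 + α), -1 + 1 / 4 * (r - 1) ^ 2 ≤ renormalizedPotential V r)
    {I₁₂₃ I₄₅ C₁ C₂ C₃ : ℝ} (hC₁ : 0 ≤ C₁)
    (hsplit : interactionEnergy V y = I₁₂₃ + I₄₅)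
    (h39 : ∑ p ∈ shortRangePairs α y, (renormalizedPotential V (dist (y p.1) (y p.2)) -
        C₁ * α * (dist (y p.1) (y p.2) - 1) ^ 2) - C₂ * α * (defects α y).card ≤ I₁₂₃)
    (h41 : -(C₃ * α * (defects α y).card) ≤ I₄₅)
    (hsmall₁ : 8 * C₁ * α ≤ 1) (hsmall₂ : 4 * (C₂ + C₃) * α ≤ 1) :
    -3 * (N : ℝ) + 1 / 8 * ∑ p ∈ shortRangePairs α y, (dist (y p.1) (y p.2) - 1) ^ 2 +
        1 / 4 * (defects α y).card ≤ interactionEnergy V y := by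
  have h := hV.mainLocalEstimate_of_parts hα hα' hsep hquad hC₁ hsplit h39 h41 hsmall₁ hsmall₂
  have hα5 : α ≤ 1 / 5 := by linarith
  have hwin : ∀ p ∈ shortRangePairs α y, (dist (y p.1) (y p.2) - 1) ^ 2 ≤
      4 * (renormalizedPotential V (dist (y p.1) (y p.2)) + 1) := by
    intro p hp
    rw [shortRangePairs, Finset.mem_filter] at hp
    obtain ⟨-, hlt, habs⟩ := hp
    obtain ⟨h1, h2⟩ := abs_le.1 habs
    have := hV.quadratic_le_renormalizedPotential_Ioc hα5 hquad
      ⟨hsep p.1 p.2 (ne_of_lt hlt), by linarith⟩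
    linarith
  have hsum := Finset.sum_le_sum hwin
  rw [← Finset.mul_sum] at hsum
  linarith

end Theil2006

end Literature.MathematicalPhysics.StatisticalMechanics

end
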